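import Summits.ResolutionOfSingularities.ResolutionOfSingularities.Theorems.PurelyInseparableDim4SpivakovskySelectMove
import Summits.ResolutionOfSingularities.ResolutionOfSingularities.Theorems.PurelyInseparableDim4SpivakovskyOneVertex
import HarnessLib

/-!
# [OURS · res-dim4-pi PR-9c, Remark 2] Every admissible one-vertex choice wins: Lemma 3 and termination for `stratWith mp`

Cell `res-dim4-pi` (D-0157 DOOR 2), seat `res-dim4-p-11`; desk WORD #32 (d)(i).  Def-free.  Spivakovsky's Remark 2
[cite: Spivakovsky1983, §I Remark 2 («an option of several possible Γ, any one of which ultimately guarantees victory»)]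
as a theorem: for EVERY selector `mp` with `IsMinPermSel mp` (a minimal permissible `Γ_r` in the one-vertex case), the
strategy `stratWith mp` admits no infinite play through good positions with `d ≥ 1` and bounded denominators.

* §1 Lemma 3 for any selector: `sum_erase_omega_lt_one_sel`, `dt_image_move_eq_zero_sel`, `dG_image_move_lt_sel`
  (after seat p-5's `…SpivakovskyOneVertex`);
* §2 termination: `no_strategy_play_sel` / `no_strategy_play_sel'` (the proof of `…Spivakovsky`, induction on `#I`,
  verbatim with the selector threaded).

[OURS · counted 0 · AI work weaker than expert review] Kernel transcription of a 1983 combinatorial theorem used by OUR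
frame's spine game; NOTHING here is a theorem about resolution of singularities in dimension ≥ 4 / characteristic `p`.
bears_on: LADDER-RESOLUTION:D157-DOOR2 (res-dim4-pi · PR-9c Remark 2). Supports stmt-ResolutionOfSingularities-16155 (helper).
-/

set_option linter.dupNamespace false -- mandated namespace of this single-conjunct summit

open Finset
open scoped BigOperators

namespace Summit.ResolutionOfSingularities.ResolutionOfSingularities.Theorems.PIDim4

namespace Spivakovsky

variable {σ : Type} [Fintype σ] [DecidableEq σ]

/-! ## §1 Lemma 3 for any selector -/

section OneVertexSel

variable {mp : Finset σ → Pos σ → Finset σ} {I : Finset σ} {G : Pos σ} {i : σ}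

/-- In a minimal permissible `Γ = mp I G` the coordinates of `ω` off the chart sum to `< 1` (`Γ ∖ i` is not
permissible). [cite: Spivakovsky1983, §III Lemma 3] -/
theorem sum_erase_omega_lt_one_sel (hmp : IsMinPermSel mp) (hgood : Good I G) (hd : 1 ≤ dG I G)
    (hi : i ∈ mp I G) : ∑ j ∈ (mp I G).erase i, omega G j < 1 := by
  have hex := exists_perm_of_one_le_dG hgood.1 hd
  have hss : (mp I G).erase i ⊂ mp I G := Finset.erase_ssubset hi
  have hnp := (hmp I G hex).2.2 _ hss
  unfold Perm at hnp
  rw [not_and_or] at hnp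
  rcases hnp with hne | hlt
  · rw [Finset.not_nonempty_iff_eq_empty] at hne
    rw [hne, Finset.sum_empty]
    exact zero_lt_one
  · push Not at hlt
    obtain ⟨g, hg, hg1⟩ := hlt
    exact lt_of_le_of_lt (Finset.sum_le_sum fun j _ => omega_le hg j) hg1

/-- **Lemma 3 (a) for any selector**: in the one-vertex regime the move leads again to a one-vertex position.
[cite: Spivakovsky1983, §III Lemma 3] -/
theorem dt_image_move_eq_zero_sel (hmp : IsMinPermSel mp) (hgood : Good I G) (hd : 1 ≤ dG I G) (hdt : dt I G = 0)
    (hi : i ∈ stratWith mp I G) : dt I (G.image (move (stratWith mp I G) i)) = 0 := by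
  have hG := hgood.1
  have hω : omega G ∈ G := (dt_eq_zero_iff hgood).mp hdt
  have hex := exists_perm_of_one_le_dG hG hd
  have hstrat : stratWith mp I G = mp I G := stratWith_eq_sel hdt
  have hspec := hmp I G hex
  have hΓI : stratWith mp I G ⊆ I := hstrat ▸ hspec.1
  have hPerm : Perm (stratWith mp I G) G := hstrat ▸ hspec.2.1
  have hgood' : Good I (G.image (move (stratWith mp I G) i)) := good_image_move hgood hΓI hPerm hi
  rw [dt_eq_zero_iff hgood', omega_image_move_eq hω]
  exact Finset.mem_image_of_mem _ hω

/-- **Lemma 3 (b) for any selector**: in the one-vertex regime the move makes `d(G)` drop strictly.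
[cite: Spivakovsky1983, §III Lemma 3] -/
theorem dG_image_move_lt_sel (hmp : IsMinPermSel mp) (hgood : Good I G) (hd : 1 ≤ dG I G) (hdt : dt I G = 0)
    (hi : i ∈ stratWith mp I G) : dG I (G.image (move (stratWith mp I G) i)) < dG I G := by
  have hG := hgood.1
  have hω : omega G ∈ G := (dt_eq_zero_iff hgood).mp hdt
  have hex := exists_perm_of_one_le_dG hG hd
  have hstrat : stratWith mp I G = mp I G := stratWith_eq_sel hdt
  have hspec := hmp I G hex
  have hΓI : stratWith mp I G ⊆ I := hstrat ▸ hspec.1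
  have hi' : i ∈ mp I G := hstrat ▸ hi
  have hdt' := dt_image_move_eq_zero_sel hmp hgood hd hdt hi
  rw [dG_eq_sum_omega_of_dt_eq_zero (hG.image _) hdt', dG_eq_sum_omega_of_dt_eq_zero hG hdt,
    omega_image_move_eq hω, sum_move_omega_eq hΓI hi]
  have hlt := sum_erase_omega_lt_one_sel hmp hgood hd hi'
  rw [← hstrat] at hlt
  linarith

end OneVertexSel

/-! ## §2 Termination for any selector -/

section Termination

variable {mp : Finset σ → Pos σ → Finset σ} {I : Finset σ}

/-! ### Case (A): the one-vertex regime cannot last for ever -/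

/-- Once `d(G̃) = 0` along a strategy play, it stays `0`. [cite: Spivakovsky1983, §III Lemma 3] -/
theorem dt_eq_zero_of_le_sel (hmp : IsMinPermSel mp) {P : ℕ → Pos σ} {ι : ℕ → σ} (hgood : ∀ l, Good I (P l)) (hd : ∀ l, 1 ≤ dG I (P l))
    (hι : ∀ l, ι l ∈ stratWith mp I (P l)) (hstep : ∀ l, P (l + 1) = (P l).image (move (stratWith mp I (P l)) (ι l)))
    {l₀ : ℕ} (h₀ : dt I (P l₀) = 0) : ∀ m, dt I (P (l₀ + m)) = 0 := by
  intro m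
  induction m with
  | zero => simpa using h₀
  | succ m ih =>
    rw [← add_assoc, hstep]
    exact dt_image_move_eq_zero_sel hmp (hgood _) (hd _) ih (hι _)

/-- **Case (A)**: a strategy play with bounded denominators and `d ≥ 1` never reaches `d(G̃) = 0` — after that
`N·d(G)` would be a strictly decreasing sequence of integers `≥ N`. [cite: Spivakovsky1983, §III Lemma 3, p. 432] -/
theorem no_play_of_dt_eq_zero_sel (hmp : IsMinPermSel mp) {N : ℕ} (hN : 0 < N) {P : ℕ → Pos σ} {ι : ℕ → σ}
    (hgood : ∀ l, Good I (P l)) (hden : ∀ l, Den N (P l)) (hd : ∀ l, 1 ≤ dG I (P l))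
    (hι : ∀ l, ι l ∈ stratWith mp I (P l)) (hstep : ∀ l, P (l + 1) = (P l).image (move (stratWith mp I (P l)) (ι l)))
    {l₀ : ℕ} (h₀ : dt I (P l₀) = 0) : False := by
  have hdt := dt_eq_zero_of_le_sel hmp hgood hd hι hstep h₀
  -- integral values `z m = N · d(P (l₀ + m))`
  have hz : ∀ m, ∃ z : ℤ, dG I (P (l₀ + m)) * N = z := fun m => exists_int_dG (hden _) (hgood _).1 I
  choose z hz using hz
  have hdrop : ∀ m, z (m + 1) < z m := by
    intro m
    have hlt : dG I (P (l₀ + m + 1)) < dG I (P (l₀ + m)) := by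
      rw [hstep]
      exact dG_image_move_lt_sel hmp (hgood _) (hd _) (hdt m) (hι _)
    have hNq : (0 : ℚ) < N := by exact_mod_cast hN
    have : (z (m + 1) : ℚ) < z m := by
      rw [← hz m, ← hz (m + 1), ← add_assoc]
      exact mul_lt_mul_of_pos_right hlt hNq
    exact_mod_cast this
  have hfloor : ∀ m, (N : ℤ) ≤ z m := by
    intro m
    have : (N : ℚ) ≤ z m := by
      rw [← hz m]
      have h1 := hd (l₀ + m)
      have hNq : (0 : ℚ) ≤ N := by exact_mod_cast hN.le
      nlinarith
    exact_mod_cast this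
  have hbound : ∀ m, z m ≤ z 0 - m := by
    intro m
    induction m with
    | zero => simp
    | succ m ih => have := hdrop m; push_cast; omega
  have h1 := hbound ((z 0).toNat + 1)
  have h2 := hfloor ((z 0).toNat + 1)
  push_cast at h1
  omega

/-! ### The theorem: no infinite play of `stratWith mp` (induction on `#I`) -/

/-- **Spivakovsky's theorem, generator form.**  For every index set `I`: there is NO infinite sequence of good
positions on `I` with denominators bounded by some `N > 0` and `d ≥ 1` throughout, driven by the strategy
`strat` against arbitrary answers of player B.  [cite: Spivakovsky1983, Theorem (§I) and §III pp. 431–432] -/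
theorem no_strategy_play_sel (hmp : IsMinPermSel mp) : ∀ (n : ℕ) (I : Finset σ), I.card ≤ n → ∀ (N : ℕ), 0 < N →
    ∀ (P : ℕ → Pos σ) (ι : ℕ → σ), (∀ l, Good I (P l)) → (∀ l, Den N (P l)) → (∀ l, 1 ≤ dG I (P l)) →
      (∀ l, ι l ∈ stratWith mp I (P l)) → (∀ l, P (l + 1) = (P l).image (move (stratWith mp I (P l)) (ι l))) → False := by
  intro n
  induction n with
  | zero =>
    intro I hI N _ P ι hgood _ hd _ _
    have hI0 : I = ∅ := Finset.card_eq_zero.mp (Nat.le_zero.mp hI)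
    subst hI0
    obtain ⟨g, hg, hgd⟩ := exists_dG_eq (∅ : Finset σ) (hgood 0).1
    rw [Finset.sum_empty] at hgd
    have := hd 0
    linarith
  | succ n ih =>
    intro I hI N hN P ι hgood hden hd hι hstep
    -- Case (A): the one-vertex regime is reached
    by_cases hA : ∃ l₀, dt I (P l₀) = 0
    · obtain ⟨l₀, h₀⟩ := hA
      exact no_play_of_dt_eq_zero_sel hmp hN hgood hden hd hι hstep h₀
    push Not at hA
    -- Case (B): `d(G̃) ≠ 0` for ever.  (B1) `N · d(G̃)` is an antitone sequence of naturals, hence stabilises.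
    have hmono : ∀ l, dt I (P (l + 1)) ≤ dt I (P l) := fun l => by
      rw [hstep]; exact dt_image_move_le_sel hmp (hgood l) (hd l) (hA l) (hι l)
    have hnat : ∀ l, ∃ m : ℕ, dt I (P l) * N = m := fun l => exists_nat_dt (hgood l) (hden l)
    choose f hf using hnat
    have hNq : (0 : ℚ) < N := by exact_mod_cast hN
    have hfmono : ∀ l, f (l + 1) ≤ f l := fun l => by
      have : (f (l + 1) : ℚ) ≤ f l := by
        rw [← hf, ← hf]; exact mul_le_mul_of_nonneg_right (hmono l) hNq.le
      exact_mod_cast this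
    obtain ⟨l₀, hl₀⟩ := exists_stable_of_antitone hfmono
    have hconst : ∀ l, l₀ ≤ l → dt I (P l) = dt I (P l₀) := fun l hl => by
      have h1 : dt I (P l) * N = dt I (P l₀) * N := by rw [hf, hf, hl₀ l hl]
      exact mul_right_cancel₀ hNq.ne' h1
    have heq : ∀ l, l₀ ≤ l → dt I ((P l).image (move (stratWith mp I (P l)) (ι l))) = dt I (P l) := fun l hl => by
      rw [← hstep, hconst l hl, hconst (l + 1) (by omega)]
    -- (B2) from `l₀` on, `S` is a non-decreasing chain inside `I`, hence stabilises at `l₁ = l₀ + m₀`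
    have hchain : ∀ m, Sset I (P (l₀ + m)) ⊆ Sset I (P (l₀ + m + 1)) := fun m => by
      rw [hstep]
      exact Sset_subset_Sset_image_move_sel hmp (hgood _) (hd _) (hA _) (hι _) (heq _ (by omega))
    obtain ⟨m₀, hm₀⟩ := exists_stable_of_chain (T := fun m => Sset I (P (l₀ + m)))
      (fun m => by simpa [add_assoc] using hchain m) (fun _ => Sset_subset)
    set l₁ := l₀ + m₀ with hl₁
    set S := Sset I (P l₁) with hSdef
    have hS : ∀ m, Sset I (P (l₁ + m)) = S := fun m => by
      have := hm₀ (m₀ + m) (by omega)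
      simpa [hl₁, add_assoc] using this
    have hS' : ∀ m, Sset I ((P (l₁ + m)).image (move (stratWith mp I (P (l₁ + m))) (ι (l₁ + m)))) =
        Sset I (P (l₁ + m)) := fun m => by
      rw [← hstep, hS m, show l₁ + m + 1 = l₁ + (m + 1) by omega, hS (m + 1)]
    have heq₁ : ∀ m, dt I ((P (l₁ + m)).image (move (stratWith mp I (P (l₁ + m))) (ι (l₁ + m)))) =
        dt I (P (l₁ + m)) := fun m => heq _ (by omega)
    -- (B3) from `l₁` on the derived sets are non-empty and perform a strategy play on `I₁ = I ∖ S`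
    have hne : ∀ m, (derive I (P (l₁ + m))).Nonempty := fun m => by
      by_contra hempty
      rw [Finset.not_nonempty_iff_eq_empty] at hempty
      have h1 := hι (l₁ + m)
      rw [stratWith_eq_Sset (hgood _) (hA _) hempty] at h1
      exact not_mem_Sset_of_dt_eq_sel hmp (hgood _) (hd _) (hA _) (hι _) (heq₁ m) h1
    set Q : ℕ → Pos σ := fun m => derive I (P (l₁ + m)) with hQ
    set κ : ℕ → σ := fun m => ι (l₁ + m) with hκ
    have hI1 : ∀ m, I1 I (P (l₁ + m)) = I \ S := fun m => by rw [I1, hS m]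
    have hQstep : ∀ m, Q (m + 1) = (Q m).image (move (stratWith mp (I \ S) (Q m)) (κ m)) := fun m => by
      simp only [hQ, hκ]
      rw [show l₁ + (m + 1) = l₁ + m + 1 by omega, hstep, ← hI1 m]
      exact derive_image_move_sel hmp (hgood _) (hd _) (hA _) (hι _) (heq₁ m) (hS' m) (hne m)
    have hκmem : ∀ m, κ m ∈ stratWith mp (I \ S) (Q m) := fun m => by
      simp only [hQ, hκ]
      rw [← hI1 m]
      have hgood' : Good I ((P (l₁ + m)).image (move (stratWith mp I (P (l₁ + m))) (ι (l₁ + m)))) := by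
        rw [← hstep, show l₁ + m + 1 = l₁ + (m + 1) by omega]; exact hgood _
      exact (stratWith_image_move hmp (hgood _) (hd _) (hA _) (hι _) hgood' (heq₁ m) (hS' m) (hne m)).2
    have hQgood : ∀ m, Good (I \ S) (Q m) := fun m => by
      simp only [hQ]; rw [← hI1 m]; exact good_derive (hgood _) (hne m)
    have hQd : ∀ m, 1 ≤ dG (I \ S) (Q m) := fun m => by
      simp only [hQ]; rw [← hI1 m]; exact one_le_dG_derive (hgood _) (hd _) (hA _) (hne m)
    -- denominators of the derived play: pick one for `Q 0`, the moves preserve it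
    obtain ⟨N', hN', hden'0⟩ := exists_den (Q 0)
    have hden' : ∀ m, Den N' (Q m) := fun m => by
      induction m with
      | zero => exact hden'0
      | succ m ihm => rw [hQstep]; exact den_image_move ihm _ _
    -- `#(I ∖ S) < #I ≤ n + 1`
    have hcard : (I \ S).card ≤ n := by
      have hlt : (I1 I (P l₁)).card < I.card := card_I1_lt (hgood _) (hA _)
      have h0 : I1 I (P l₁) = I \ S := by simpa using hI1 0
      rw [h0] at hlt
      omega
    exact ih (I \ S) hcard N' hN' Q κ hQgood hden' hQd hκmem hQstep

/-- **Spivakovsky's theorem, play form at `I`** (the bound `n` instantiated). [cite: Spivakovsky1983, Theorem (§I)] -/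
theorem no_strategy_play_sel' (hmp : IsMinPermSel mp) (I : Finset σ) {N : ℕ} (hN : 0 < N) (P : ℕ → Pos σ) (ι : ℕ → σ)
    (hgood : ∀ l, Good I (P l)) (hden : ∀ l, Den N (P l)) (hd : ∀ l, 1 ≤ dG I (P l))
    (hι : ∀ l, ι l ∈ stratWith mp I (P l)) (hstep : ∀ l, P (l + 1) = (P l).image (move (stratWith mp I (P l)) (ι l))) :
    False :=
  no_strategy_play_sel hmp I.card I le_rfl N hN P ι hgood hden hd hι hstep

end Termination

end Spivakovsky

end Summit.ResolutionOfSingularities.ResolutionOfSingularities.Theorems.PIDim4
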